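import Summits.BirchSwinnertonDyer.BirchSwinnertonDyer.Theorems.ClassRecordThreeEulerHalvesAtThreeCartanSupplyMonomialCuspTorus
import Summits.BirchSwinnertonDyer.BirchSwinnertonDyer.Theorems.ClassRecordThreeEulerHalvesAtThreeCartanSupplyVirtualSupply
import Summits.BirchSwinnertonDyer.BirchSwinnertonDyer.Theorems.ClassRecordThreeEulerHalvesAtThreeCartanSupplyCubicLatticeSupply
import HarnessLib

/-!
# VIRTUAL REALISATION, VI — `χ_W = Ind_{ZN}^G λ − Ind_{T_C}^G θ` for `q ≡ 2 (3)`, and the net theorem: `CartanTorusLatticeSupply` HOLDS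

Helper file riding `--supports stmt-BirchSwinnertonDyer-19109` (crux `EulerHalvesAtThree`; UNREGISTERED sub-line `Cruxes/EulerHalvesAtThree/Lines/cartan_corr`,
seat `bsd-idea-10` g13). §1: the class function `χ_W = cubicNewvectorChar q` is, for `q ≡ 2 (mod 3)`, `q ≥ 5`, the DIFFERENCE of the two monomial
characters of files IV and V (`cuspChar_eq`, class by class: `q−1 = (q²−1) − (q²−q)`, `−1 = −1 − 0`, `0 = 0 − 0`, `∓2±1 = 0 − (θ(e)+θ(e)⁻¹)`).
§2 THE NET THEOREM: over `k = ℂ` (`ζ₃ = e^{2πi/3}`, `ψ = e^{2πi·/q}`), files III and §1 give, for every prime `q ∉ {2,3}`, honest representations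
`ρ_A, ρ_B` with `χ_W = χ_{ρ_A} − χ_{ρ_B}`; the landed field-agnostic engine `CartanSupply.convolutionAt_of_virtual` and NORM ONE
(`NormOne.sum_sq_eq_card`) then yield `CartanConvolutionSupply` (`cartanConvolutionSupply_holds`), hence
**`cartanTorusLatticeSupply_holds : CartanTorusLatticeSupply`** — the statement of the SUPPLY stub `stub_cartanTorusLatticeSupply` of the registered
line `cartan` v11 of crux 23422, proved outright (no hypothesis), by a road (monomial representations over `ℂ`) different from the LEAD's integral
Eisenstein descent (`CubicLattice.cartanTorusLatticeSupplyAt`, the `q ≡ 1 (3)` half); and its cuspidal specialisation `cartanTorusLatticeSupplyCusp_holds :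
CubicLattice.CartanTorusLatticeSupplyCusp` (the SUPPLY stub of the LEAD's turnkey v12).
HONEST FRAMING: this proves the representation-theoretic SUPPLY half only; the NUM stub (`stub_cartanOnePlaceDegreeLawAtThree`, the modular-degree
3-adic law), crux 23422, crux 19109 and every summit statement remain OPEN; nothing here is BSD for any curve. [folklore; cite: Bump1997 §4.1]
-/

set_option linter.dupNamespace false
set_option autoImplicit false

noncomputable section

namespace Summit.BirchSwinnertonDyer.BirchSwinnertonDyer.Theorems.CartanSupply.Monomial

open Summit.BirchSwinnertonDyer.BirchSwinnertonDyer.Theorems.CartanDegree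
open Summit.BirchSwinnertonDyer.BirchSwinnertonDyer.Theorems.CartanTorusCubeCut
open scoped Classical

section cusp

variable {q : ℕ} [Fact q.Prime] {k : Type*} [Field k] {ζ : kˣ} (hζ : IsPrimitiveRoot ζ 3) {η : Mat q}

/-! ## §1 `χ_W` for `q ≡ 2 (3)`: values and the difference formula -/

omit [Fact q.Prime] in
/-- PROVED: `χ_W(scalar) = q − 1` (`q ≢ 1 (3)`). [folklore] -/
theorem char_scalar_cusp [Fact q.Prime] (hq3 : q % 3 = 2) {g : G q} (hs : IsScalarMat (g : Mat q)) : cubicNewvectorChar q g = (q : ℤ) - 1 := by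
  have h1 : ¬ q % 3 = 1 := by omega
  have hΔ := PS.discr_eq_zero_of_isScalar hs
  unfold cubicNewvectorChar cubicNewvectorCharMat
  simp only [h1, hΔ, hs, if_true, if_false]

omit [Fact q.Prime] in
/-- PROVED: `χ_W(parabolic) = −1` (`q ≢ 1 (3)`). [folklore] -/
theorem char_parabolic_cusp [Fact q.Prime] (hq3 : q % 3 = 2) {g : G q} (hns : ¬ IsScalarMat (g : Mat q))
    (hΔ : (g : Mat q).trace ^ 2 - 4 * (g : Mat q).det = 0) : cubicNewvectorChar q g = -1 := by
  have h1 : ¬ q % 3 = 1 := by omega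
  unfold cubicNewvectorChar cubicNewvectorCharMat
  simp only [h1, hΔ, hns, if_true, if_false]

omit [Fact q.Prime] in
/-- PROVED: `χ_W(split regular) = 0` (`q ≢ 1 (3)`). [folklore] -/
theorem char_split_cusp [Fact q.Prime] (hq3 : q % 3 = 2) {g : G q} (hr : HasRatEigenvalue (g : Mat q))
    (hΔ : (g : Mat q).trace ^ 2 - 4 * (g : Mat q).det ≠ 0) : cubicNewvectorChar q g = 0 := by
  have h1 : ¬ q % 3 = 1 := by omega
  unfold cubicNewvectorChar cubicNewvectorCharMat
  simp only [h1, hΔ, hr, if_true, if_false]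

/-- PROVED: `χ_W(elliptic) = −2 ∕ 1` by the cube test (`q ≢ 1 (3)`, `q` odd). [folklore] -/
theorem char_elliptic_cusp (hq2 : q ≠ 2) (hq3 : q % 3 = 2) {g : G q} (hg : ¬ HasRatEigenvalue (g : Mat q)) :
    cubicNewvectorChar q g = if (g : Mat q) ^ ((q - 1) * (q + 1) / 3) = 1 then -2 else 1 := by
  have h1 : ¬ q % 3 = 1 := by omega
  have hΔ := PS.discr_ne_zero_of_not_hasRatEigenvalue hq2 hg
  unfold cubicNewvectorChar cubicNewvectorCharMat
  simp only [h1, hΔ, hg, if_false, sq_sub_one_eq]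

/-- PROVED — **THE CUSPIDAL CASE**: for `q ≡ 2 (mod 3)`, `q ≥ 5`, a non-trivial additive character `ψ` and a primitive cube root of unity in a
field of characteristic `0`, `χ_W = χ(Ind_{ZN}^G ψ(b/a)) − χ(Ind_{T_C}^G θ)` on all of `GL₂(𝔽_q)`. [folklore; cite: Bump1997 §4.1] -/
theorem cuspChar_eq [CharZero k] (hq2 : q ≠ 2) (hq3 : q % 3 = 2) (hq5 : 5 ≤ q) (hη : ¬ HasRatEigenvalue η) {ψ : AddChar (ZMod q) k}
    (hψ : ψ ≠ 1) (g : G q) :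
    (cubicNewvectorChar q g : k) =
      (monRep (znSub q) (znChar ψ)).character g - (monRep (torusSubgroup η) (torusChar hζ hη hq5)).character g := by
  by_cases hs : IsScalarMat (g : Mat q)
  · rw [znChar_scalar ψ hs, torusInd_scalar hζ hη hq5 hq3 hs, char_scalar_cusp hq3 hs]; push_cast; ring
  by_cases hΔ : (g : Mat q).trace ^ 2 - 4 * (g : Mat q).det = 0
  · rw [znChar_parabolic hψ hs hΔ hq2, torusInd_of_hasRatEigenvalue hζ hη hq5 hs (NormOne.hasRatEigenvalue_of_discr_eq_zero hq2 hΔ),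
      char_parabolic_cusp hq3 hs hΔ]; push_cast; ring
  by_cases hr : HasRatEigenvalue (g : Mat q)
  · rw [znChar_of_discr_ne_zero ψ hΔ, torusInd_of_hasRatEigenvalue hζ hη hq5 hs hr, char_split_cusp hq3 hr hΔ]; push_cast; ring
  · rw [znChar_of_discr_ne_zero ψ hΔ, torusInd_elliptic hζ hq2 hη hq5 hq3 hr, char_elliptic_cusp hq2 hq3 hr]
    split_ifs <;> push_cast <;> ring

end cusp

/-! ## §2 The net theorem over `ℂ`: `CartanConvolutionSupply` and `CartanTorusLatticeSupply` hold -/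

section net

/-- PROVED: a primitive cube root of unity in `ℂˣ`. [folklore] -/
theorem exists_primitiveRoot_three_units : ∃ ζ : ℂˣ, IsPrimitiveRoot ζ 3 := by
  have h3r : IsPrimitiveRoot (Complex.exp (2 * Real.pi * Complex.I / (3 : ℕ))) 3 := Complex.isPrimitiveRoot_exp 3 (by norm_num)
  have hu : IsUnit (Complex.exp (2 * Real.pi * Complex.I / (3 : ℕ))) := h3r.isUnit (by norm_num)
  exact ⟨hu.unit, IsPrimitiveRoot.coe_units_iff.1 (by rw [IsUnit.unit_spec]; exact h3r)⟩

/-- PROVED: a non-trivial additive character of `𝔽_q` with values in `ℂ` (`q` prime). [folklore] -/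
theorem exists_addChar_ne_one (q : ℕ) [hq : Fact q.Prime] : ∃ ψ : AddChar (ZMod q) ℂ, ψ ≠ 1 := by
  haveI : NeZero q := ⟨hq.out.ne_zero⟩
  haveI : Fact (1 < q) := ⟨hq.out.one_lt⟩
  have hqr : IsPrimitiveRoot (Complex.exp (2 * Real.pi * Complex.I / q)) q := Complex.isPrimitiveRoot_exp q hq.out.ne_zero
  refine ⟨AddChar.zmodChar q hqr.pow_eq_one, fun h => ?_⟩
  have h1 : AddChar.zmodChar q hqr.pow_eq_one 1 = 1 := by rw [h, AddChar.one_apply]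
  rw [AddChar.zmodChar_apply, ZMod.val_one, pow_one] at h1
  exact hqr.ne_one hq.out.one_lt h1

/-- PROVED: the character of the zero representation vanishes. [folklore] -/
theorem character_one_fin_zero (q : ℕ) (g : G q) : (1 : Representation ℂ (G q) (Fin 0 → ℂ)).character g = 0 := by
  show LinearMap.trace _ _ ((1 : Representation ℂ (G q) (Fin 0 → ℂ)) g) = 0
  rw [MonoidHom.one_apply, LinearMap.trace_one, Module.finrank_fin_fun, Nat.cast_zero]

/-- PROVED — **`CartanConvolutionSupply` HOLDS**: for every prime `q ∉ {2, 3}` the convolution identities (α), (β) of the Cartan correspondence,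
from the VIRTUAL REALISATION over `ℂ` (`χ_W = χ_{ρ_A} − χ_{ρ_B}`: principal series `Ind_B^G χ₃(a/d)` and `0` for `q ≡ 1 (3)`; `Ind_{ZN}^G ψ(b/a)` and
`Ind_{T_C}^G θ` for `q ≡ 2 (3)`), the field-agnostic engine `convolutionAt_of_virtual` and NORM ONE. [folklore; cite: Bump1997 §4.1] -/
theorem cartanConvolutionSupply_holds : CartanConvolutionSupply := by
  intro q hq h3 hq2
  obtain ⟨ζ, hζ⟩ := exists_primitiveRoot_three_units
  rcases prime_mod_three hq.out h3 with h1 | hq3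
  · exact convolutionAt_of_virtual hq2 h3 (monRep (borelSub q) (borelChar hζ h1)) (1 : Representation ℂ (G q) (Fin 0 → ℂ))
      (fun g => by rw [character_one_fin_zero, sub_zero, psChar_eq hζ h1 g]) (NormOne.sum_sq_eq_card h3 hq2)
  · have hq5 : 5 ≤ q := by have := hq.out.two_le; omega
    obtain ⟨η, hη⟩ := exists_not_hasRatEigenvalue hq2
    obtain ⟨ψ, hψ⟩ := exists_addChar_ne_one q
    exact convolutionAt_of_virtual hq2 h3 (monRep (znSub q) (znChar ψ)) (monRep (torusSubgroup η) (torusChar hζ hη hq5))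
      (fun g => cuspChar_eq hζ hq2 hq3 hq5 hη hψ g) (NormOne.sum_sq_eq_card h3 hq2)

/-- PROVED — **`CartanTorusLatticeSupply` HOLDS** (the statement of the SUPPLY stub `stub_cartanTorusLatticeSupply` of line `cartan` v11 of crux 23422):
for every prime `q ∉ {2,3}` a Cartan torus lattice with character `χ_W` and the fixed-vector ranks exists — from `cartanConvolutionSupply_holds` by the
landed chain `CartanConvolutionSupply → CartanTorusLatticeSupply`. The NUM stub and every crux ∕ summit statement remain open. [folklore] -/
theorem cartanTorusLatticeSupply_holds : CartanCorrespondence.CartanTorusLatticeSupply :=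
  cartanTorusLatticeSupply_of_convolutionSupply cartanConvolutionSupply_holds

/-- PROVED — **the cuspidal half `CubicLattice.CartanTorusLatticeSupplyCusp`** (the SUPPLY stub of the LEAD's turnkey `cartan` v12: primes
`q ≡ 2 (mod 3)`, `q ≥ 5`) — a specialisation of `cartanTorusLatticeSupply_holds`. [folklore] -/
theorem cartanTorusLatticeSupplyCusp_holds : CubicLattice.CartanTorusLatticeSupplyCusp :=
  fun q hq h2 _ => cartanTorusLatticeSupply_holds q hq (by omega)

end net

end Summit.BirchSwinnertonDyer.BirchSwinnertonDyer.Theorems.CartanSupply.Monomial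

end
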